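import Summits.Ventures.QEC.Census.CertCheck
import HarnessLib

/-!
# Distance certificate DATA for the census row `2bga-g30-A0.1.3.10-B0.1.9.16` (family GB) as `TB_g30_A0_1_3_10_B0_1_9_16.cert` — emitted by qec-type-07 (07.MITMK)

Source certificate: `cert/search-8/j264005/2bga-g30-A0.1.3.10-B0.1.9.16.certA.json` — kernel A, id (sha256) `ff932ae9cf78364cdf01b34f8e6615231ac670cdc0b44d3d1e300e1844aa1783` (`certA=ff932ae9cf78364c`),
lower-bound methods bz (Z) / bz (X) as RUN BY KERNEL A; here only its matrices,
upper witnesses and allow-lists are data — the lower bound is RE-ESTABLISHED in the kernel by the meet-in-the-middle lane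
`Census/CertMitmK.lean` (sibling files `MitmKZ*.lean` — Z side; the X side by the kernel X↔Z swap of `Census/CertCheckXZSwap.lean`), the row theorem is `GB/TB_g30_A0_1_3_10_B0_1_9_16/Distance.lean`.
Code: n = 60, 30 X-checks, 30 Z-checks; construction {"type": "explicit"}; generators
`/work/gens/q/2bga-g30-A0.1.3.10-B0.1.9.16.json` (matrix_sha256 `f90e1827c22fc4d5c3790bbfd3bfecdde11c6191ff57d0f3f2393007f882edf6`); claimed (n, k, dZ, dX) =
(60, 8, 8, 8) — a CLAIM of the certificate until the sibling theorems;
printed/third-party value: none — a census-discovered code (no parameters for it are claimed in print; any TABLE `d_printed` entry is a census/third-method comparator, wording qec-lead's).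
Allow-lists (`found`): side Z: the certificate's 0 words verbatim; side X: the certificate's list verbatim (not used: the X side follows by the kernel X↔Z swap, `Distance.lean`).
Format = qec-search-7's `emit_lean.py` (`Census/<F>/<Code>/Cert.lean` convention: supports as binary numerals, bit `j` =
qubit `j` of the gens file, identity layout). This file is DATA: no theorem, no `decide`. Generated 2026-08-27T12:37Z by
HOME/census/type-07/emit_mitmk.py; do not edit by hand — re-emit.
-/

namespace Summit.Ventures.QEC.Census.TB_g30_A0_1_3_10_B0_1_9_16

/-- The distance certificate of `TB_g30_A0_1_3_10_B0_1_9_16` as a `DistCert` literal (CERT-FORMAT v1 kernel fields; certificate id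
`ff932ae9cf78364c`): `n = 60`, `HX`/`HZ` = the 30 + 30 check rows (words as binary numerals (bit `j` = qubit `j`)), side Z =
(d := 8, weight-8 Z-logical witness, its non-membership witness, allow-list of 0 stabilizer words with
their row decompositions), side X likewise (d := 8, 0 words). -/
def cert : DistCert where
  n := 60
  HX := [
    70921721218059, 141843442436118, 283686884872236, 567373769744472, 1134747539488944, 2269495078977888,
    4538990157955776, 9077980315911552, 18155960631823104, 36311921263646208, 72623842527292416, 145247685054584832,
    290495370109169664, 580990740218339328, 9059976903573504, 18119953807147008, 36239907614294016, 72479815228588032,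
    144959630457176064, 289919260914352128, 579838520754962433, 6755537976819714, 13511075953639428, 27022151907278856,
    54044303814557712, 108088607629115424, 216177215258230848, 432354429442719873, 864708858885439746, 576496213164032517]
  HZ := [
    721701841898848257, 290482179190849539, 580964358381699078, 9007213230293004, 18014426460586008, 36028852921172016,
    72057705842344032, 144115411684688064, 288230823369376128, 576461645665010433, 1787796915714, 3575593831428,
    7151187662856, 14302375325712, 28604750651424, 57209501302848, 114417928863873, 228835857727746,
    457671715455492, 915343430910984, 1830686861821968, 3661373723643936, 7322747447287872, 14645494894575744,
    29290989789151488, 58581979578302976, 117163959156605952, 234327918313211904, 468655836626423808, 937311673252847616]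
  sideZ := { d := 8, witness := 292777991145029632, nonmember := 16641190141,
             found := [] }
  sideX := { d := 8, witness := 13228767719584, nonmember := 119304647,
             found := [] }

end Summit.Ventures.QEC.Census.TB_g30_A0_1_3_10_B0_1_9_16
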